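import Literature.NumberTheory.LFunctions.CentralValueFamilyNontrivialTwist
import Literature.NumberTheory.LFunctions.CentralValueFamilyTwistedWindow
import Literature.NumberTheory.LFunctions.CentralValueFamilyDevices
import HarnessLib

/-!
# The ½-proportion edge, level-averaged: non-trivial twists only (repair of the `D = 1` explosion)

Topic `Literature/NumberTheory/LFunctions` (namespace
`Literature.NumberTheory.LFunctions.CentralValueFamilyHalfEdge`). GLUE and PROOFS, zero named
facts. Continues `CentralValueFamilyNontrivialTwist` (which repairs the POINTWISE chain) on the
LEVEL-AVERAGED side of the edge layer.

THE DEFECT (found by ls-lit-typer-4, kernel `not_mixedOverMass_of_evenMassPos`): every hypothesis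
shape of `CentralValueFamilyHalfEdge` that quantifies «for all real primitive `χ mod D` with
`D ≤ X^δ`» admits `D = 1`, the trivial character, for which Mathlib's `L(1, 𝟙) = ζ(1) = (γ − log 4π)/2`
is NEGATIVE. On the level-averaged side this makes `MixedOverMassAvg compatibleWindow δ` FALSE for
`𝓗_k(N)` (at `D = 1` the compatible window is the whole squarefree window) — so
`lOne_lowerBound_of_EStarFamLevelAvg{,_of_nonnegOn,_compatibleWindow}`, `lOne_lowerBound_of_plain_and_twisted`
and `twistedExcess_le_iwaniecSarnakFamily` are VACUOUS as instantiated — and it makes the typed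
target `EStarFamLevelAvg compatibleWindow (½+η)` silently demand the PLAIN-window proportion at
`D = 1` (over-strong). In print `χ = χ_D` is a Kronecker symbol, `D > 1`
[IwaniecConversations2006, §4 p. 89]; nothing printed is at fault.

THE REPAIR (landed declarations untouched):
* `CentralValueFamily.ntWindow win` — the window scheme GUARDED to non-trivial conductors: `win X D χ`
  if `1 < D`, `∅` otherwise. Every landed window shape (`WindowBound`, `WindowCompatible`,
  `EStarFamLevelAvg`, `TwistedHalfAvg`, `MixedOverMassAvg`, `IsSignedHalf`, `TwistedExcessLower`)
  evaluated on a guarded scheme says NOTHING at `D = 1` (empty sums) and the same thing as before at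
  `D > 1`; so the typed target of a level-average card is, from now on,
  `(iwaniecSarnakFamily k).EStarFamLevelAvg (ntWindow compatibleWindow) (½+η) 2 δ`
  (`EStarFamLevelAvg_ntWindow_iff` spells it out with the guard `1 < D` explicit).
* `EvenShareAvg win δ` and `MixedOverTotalMassAvg win δ` — the level-averaged forms of
  ls-lit-typer-4's `EvenShare` / `MixedOverTotalMass` (TOTAL mass, `1 < D`): the printed content of
  (7.3)+(7.4) on a window, and the even share of the mass (root-number equidistribution, NOT in §7).
* `lOne_lowerBound_of_EStarFamLevelAvg_total` — THE LEVEL-AVERAGED EDGE IMPLICATION RE-PROVED with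
  `NonnegOn` + `WindowCompatible` and the guarded / total-mass hypotheses (same pigeonhole proof as
  the landed `lOne_lowerBound_of_EStarFamLevelAvg`, instantiated only at `D ≥ 2`).
* `𝓗_k(N)`: `lOne_lowerBound_of_EStarFamLevelAvg_compatibleWindow_total` (replaces
  `…_compatibleWindow`), `lOne_lowerBound_of_plain_and_twisted_total` and
  `twistedExcess_le_iwaniecSarnakFamily_total` (replace the two closers of
  `CentralValueFamilyTwistedWindow`; the forced split `avgGoodMass_le_of_mixedOverMassAvg` of
  `CentralValueFamilyForcedSplit` is NON-vacuous on the guarded scheme, `mixedOverMassAvg_ntWindow`),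
  and the amplified-measure decision theorem in total-mass form
  `lOne_lowerBound_iwaniecSarnakFamilyAmp_total` (replaces `…Amp_ratio` of `CentralValueFamilyDevices`,
  via ls-lit-typer-4's `lOne_lowerBound_of_EStarFam_total`).

WHAT THIS IS NOT: no shape is asserted for `𝓗_k(N)`; no claim about Landau–Siegel zeros. «The
programme SEARCHES and TYPES; no claim about Landau–Siegel zeros, Theorems 1–2 of arXiv:2211.02515
or a repaired Margin232 until a kernel theorem says so.»
-/

noncomputable section

namespace Literature.NumberTheory.LFunctions.CentralValueFamilyHalfEdge

open scoped MatrixGroups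
open Finset Real CongruenceSubgroup
open Literature.NumberTheory.EllipticCurves.ModularForms
open Literature.NumberTheory.LFunctions.IwaniecSarnak

namespace CentralValueFamily

variable (𝓕 : CentralValueFamily)
variable (win : ℝ → (D : ℕ) → DirichletCharacter ℂ D → Finset 𝓕.Param)

/-! ## The guarded window scheme -/

/-- **Guarded window scheme**: `win X D χ` for non-trivial conductor `1 < D`, the EMPTY window
otherwise. Window shapes evaluated on `ntWindow win` carry no condition at `D = 1` (where `χ` is the
trivial character and Mathlib's `L(1,𝟙) = ζ(1) < 0` is junk) and the original condition at `D > 1`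
(`χ = χ_D` a genuine Kronecker symbol, §4 p. 89). [cite: IwaniecConversations2006, §4 (p. 89, χ = χ_D)] -/
def ntWindow : ℝ → (D : ℕ) → DirichletCharacter ℂ D → Finset 𝓕.Param :=
  fun X D χ => if 1 < D then win X D χ else ∅

variable {win}

/-- At a non-trivial conductor the guarded window is the window. [cite: IwaniecConversations2006, §4 (p. 89, χ = χ_D)] -/
theorem ntWindow_of_one_lt {X : ℝ} {D : ℕ} (χ : DirichletCharacter ℂ D) (hD : 1 < D) :
    𝓕.ntWindow win X D χ = win X D χ := by
  unfold ntWindow; rw [if_pos hD]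

/-- At conductor `≤ 1` the guarded window is empty. [cite: IwaniecConversations2006, §4 (p. 89, χ = χ_D)] -/
theorem ntWindow_of_not_one_lt {X : ℝ} {D : ℕ} (χ : DirichletCharacter ℂ D) (hD : ¬ 1 < D) :
    𝓕.ntWindow win X D χ = ∅ := by
  unfold ntWindow; rw [if_neg hD]

/-- Members of the guarded window are members of the window. [cite: IwaniecConversations2006, §4 (p. 89, χ = χ_D)] -/
theorem mem_of_mem_ntWindow {X : ℝ} {D : ℕ} {χ : DirichletCharacter ℂ D} {P : 𝓕.Param}
    (hP : P ∈ 𝓕.ntWindow win X D χ) : P ∈ win X D χ := by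
  by_cases hD : 1 < D
  · rwa [𝓕.ntWindow_of_one_lt χ hD] at hP
  · rw [𝓕.ntWindow_of_not_one_lt χ hD] at hP
    exact absurd hP (Finset.notMem_empty P)

/-- `WindowBound` transfers to the guarded scheme. [cite: IwaniecConversations2006, §7 (p0097:L15)] -/
theorem windowBound_ntWindow {δ K : ℝ} (h : 𝓕.WindowBound win δ K) :
    𝓕.WindowBound (𝓕.ntWindow win) δ K := by
  obtain ⟨X₀, hX⟩ := h
  exact ⟨X₀, fun X hXX D _ χ hprim hquad hD P hP =>
    hX X hXX D χ hprim hquad hD P (𝓕.mem_of_mem_ntWindow hP)⟩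

/-- `WindowCompatible` transfers to the guarded scheme. [cite: IwaniecConversations2006, §7 (p0097:L15)] -/
theorem windowCompatible_ntWindow {δ : ℝ} (h : 𝓕.WindowCompatible win δ) :
    𝓕.WindowCompatible (𝓕.ntWindow win) δ := by
  obtain ⟨X₀, hX⟩ := h
  exact ⟨X₀, fun X hXX D _ χ hprim hquad hD P hP =>
    hX X hXX D χ hprim hquad hD P (𝓕.mem_of_mem_ntWindow hP)⟩

/-- `EStarFamLevelAvg` on a scheme implies it on the guarded scheme (a weakening: the `D = 1`
conjunct is dropped). [cite: IwaniecConversations2006, §7 (7.5)] -/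
theorem EStarFamLevelAvg_ntWindow {p δ : ℝ} {a : ℕ} (h : 𝓕.EStarFamLevelAvg win p a δ) :
    𝓕.EStarFamLevelAvg (𝓕.ntWindow win) p a δ := by
  obtain ⟨X₀, hX⟩ := h
  refine ⟨X₀, fun X hXX D _ χ hprim hquad hD => ?_⟩
  by_cases h1 : 1 < D
  · rw [𝓕.ntWindow_of_one_lt χ h1]; exact hX X hXX D χ hprim hquad hD
  · rw [𝓕.ntWindow_of_not_one_lt χ h1]; simp [avgEvenMass, avgGoodMass]

/-- `TwistedHalfAvg` on a scheme implies it on the guarded scheme. [cite: IwaniecConversations2006, §7 (7.6)] -/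
theorem twistedHalfAvg_ntWindow {p δ : ℝ} {a : ℕ} (h : 𝓕.TwistedHalfAvg win p a δ) :
    𝓕.TwistedHalfAvg (𝓕.ntWindow win) p a δ := by
  obtain ⟨X₀, hX⟩ := h
  refine ⟨X₀, fun X hXX D _ χ hprim hquad hD => ?_⟩
  by_cases h1 : 1 < D
  · rw [𝓕.ntWindow_of_one_lt χ h1]; exact hX X hXX D χ hprim hquad hD
  · rw [𝓕.ntWindow_of_not_one_lt χ h1]; simp [avgEvenMass, avgGoodTwistedMass]

/-- **The guarded edge estimate, spelled out**: `EStarFamLevelAvg (ntWindow win) p a δ` says exactly: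
for all large `X` and all real primitive `χ mod D` with `1 < D ≤ X^δ`,
`p · Σ_{P ∈ win X χ} evenMass P ≤ Σ_{P ∈ win X χ} goodMass a P`. This is the typed target of a
level-average card (with `win = compatibleWindow`). [cite: IwaniecConversations2006, §7 (7.5) and p0097:L15] -/
theorem EStarFamLevelAvg_ntWindow_iff {p δ : ℝ} {a : ℕ} :
    𝓕.EStarFamLevelAvg (𝓕.ntWindow win) p a δ ↔
      ∃ X₀ : ℝ, ∀ X : ℝ, X₀ ≤ X → ∀ (D : ℕ) [NeZero D] (χ : DirichletCharacter ℂ D), χ.IsPrimitive →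
        MulChar.IsQuadratic χ → 1 < D → (D : ℝ) ≤ X ^ δ →
          p * 𝓕.avgEvenMass (win X D χ) ≤ 𝓕.avgGoodMass a (win X D χ) := by
  constructor
  · rintro ⟨X₀, hX⟩
    refine ⟨X₀, fun X hXX D _ χ hprim hquad h1 hD => ?_⟩
    have h := hX X hXX D χ hprim hquad hD
    rwa [𝓕.ntWindow_of_one_lt χ h1] at h
  · rintro ⟨X₀, hX⟩
    refine ⟨X₀, fun X hXX D _ χ hprim hquad hD => ?_⟩
    by_cases h1 : 1 < D
    · rw [𝓕.ntWindow_of_one_lt χ h1]; exact hX X hXX D χ hprim hquad h1 hD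
    · rw [𝓕.ntWindow_of_not_one_lt χ h1]; simp [avgEvenMass, avgGoodMass]

/-- A signed-half relation between two schemes survives guarding both.
[cite: IwaniecConversations2006, §7 (p0097:L15)] -/
theorem isSignedHalf_ntWindow {pw cw : ℝ → (D : ℕ) → DirichletCharacter ℂ D → Finset 𝓕.Param}
    {s : ℝ → (D : ℕ) → DirichletCharacter ℂ D → 𝓕.Param → ℝ} (h : 𝓕.IsSignedHalf pw cw s) :
    𝓕.IsSignedHalf (𝓕.ntWindow pw) (𝓕.ntWindow cw) s := by
  intro X D χ g
  by_cases h1 : 1 < D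
  · rw [𝓕.ntWindow_of_one_lt χ h1, 𝓕.ntWindow_of_one_lt χ h1]; exact h X D χ g
  · rw [𝓕.ntWindow_of_not_one_lt χ h1, 𝓕.ntWindow_of_not_one_lt χ h1]; simp

/-! ## Total mass and even share on a window; the printed moment shape, level-averaged -/

variable (win)

/-- The total `ω`-mass summed over a window. [cite: IwaniecConversations2006, §7 (7.3)] -/
def avgTotalMass (W : Finset 𝓕.Param) : ℝ :=
  ∑ P ∈ W, 𝓕.totalMass P

/-- **Even share of the mass, level-averaged**: for all large `X` and real primitive `χ mod D`,
`1 < D ≤ X^δ`, the even members over the window carry at least a fixed proportion `c > 0` of a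
POSITIVE total mass. (Root-number equidistribution on average over the window; NOT printed in §7 —
for `𝓗_k(N)` a consequence of Petersson/Kuznetsov-type asymptotics.) A hypothesis SHAPE.
[cite: IwaniecConversations2006, §7 (7.3)] -/
def EvenShareAvg (δ : ℝ) : Prop :=
  ∃ c : ℝ, 0 < c ∧ ∃ X₀ : ℝ, ∀ X : ℝ, X₀ ≤ X → ∀ (D : ℕ) [NeZero D] (χ : DirichletCharacter ℂ D),
    χ.IsPrimitive → MulChar.IsQuadratic χ → 1 < D → (D : ℝ) ≤ X ^ δ →
      c * 𝓕.avgTotalMass (win X D χ) ≤ 𝓕.avgEvenMass (win X D χ) ∧ 0 < 𝓕.avgTotalMass (win X D χ)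

/-- **(7.3) + (7.4) level-averaged, as printed: against the TOTAL mass, non-trivial twists**: for all
large `X` and real primitive `χ mod D` with `1 < D ≤ X^δ`,
`Σ_{P ∈ win} Σ_f ω_f L(½,f)L(½,f_χ) ≤ C · (Σ_{P ∈ win} Σ_f ω_f) · L(1,χ)`. A hypothesis SHAPE (for
`𝓗_k(N)` on a compatible window: summed instances of the named fact
`IwaniecSarnak.iwaniec2006_mixedMomentOverMass`). [cite: IwaniecConversations2006, §7 (7.3)–(7.4)] -/
def MixedOverTotalMassAvg (δ : ℝ) : Prop :=
  ∃ C : ℝ, 0 < C ∧ ∃ X₀ : ℝ, ∀ X : ℝ, X₀ ≤ X → ∀ (D : ℕ) [NeZero D] (χ : DirichletCharacter ℂ D),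
    χ.IsPrimitive → MulChar.IsQuadratic χ → 1 < D → (D : ℝ) ≤ X ^ δ →
      𝓕.avgMixedMoment (win X D χ) χ ≤ C * 𝓕.avgTotalMass (win X D χ) * (χ.LFunction 1).re

variable {win}

/-- Members of `evenForms` are members of `forms`. [folklore] -/
private theorem mem_forms_of_mem_evenForms_avg {P : 𝓕.Param} {f : 𝓕.Form P}
    (hf : f ∈ 𝓕.evenForms P) : f ∈ 𝓕.forms P := by
  classical
  exact (Finset.mem_filter.1 hf).1

/-- A filtered sum over a sigma-window is the iterated filtered sum. [folklore] -/
private theorem sum_sigma_filter_avg (W : Finset 𝓕.Param) (t : (P : 𝓕.Param) → Finset (𝓕.Form P))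
    (g : (P : 𝓕.Param) → 𝓕.Form P → ℝ) (q : (P : 𝓕.Param) → 𝓕.Form P → Prop)
    [∀ P, DecidablePred (q P)] :
    ∑ x ∈ (W.sigma t) with q x.1 x.2, g x.1 x.2 = ∑ P ∈ W, ∑ f ∈ t P with q P f, g P f := by
  rw [Finset.sum_filter, Finset.sum_sigma]
  refine Finset.sum_congr rfl fun P _ => ?_
  rw [Finset.sum_filter]

/-- The averaged mixed moment over a window of COMPATIBLE parameters is `≥ 0` under `NonnegOn`.
[cite: IwaniecConversations2006, §7 (p0096:L15)] -/
theorem avgMixedMoment_nonneg (hnn : 𝓕.NonnegOn) (W : Finset 𝓕.Param) {D : ℕ} [NeZero D]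
    (χ : DirichletCharacter ℂ D) (hprim : χ.IsPrimitive) (hquad : MulChar.IsQuadratic χ)
    (hcomp : ∀ P ∈ W, 𝓕.Compatible P χ) : 0 ≤ 𝓕.avgMixedMoment W χ :=
  Finset.sum_nonneg fun P hP => mixedMoment_nonneg_of_nonnegOn hnn P χ hprim hquad (hcomp P hP)

/-- The averaged even mass is at most the averaged total mass, under `NonnegOn`.
[cite: IwaniecConversations2006, §7 (7.3)] -/
theorem avgEvenMass_le_avgTotalMass (hnn : 𝓕.NonnegOn) (W : Finset 𝓕.Param) :
    𝓕.avgEvenMass W ≤ 𝓕.avgTotalMass W :=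
  Finset.sum_le_sum fun P _ => evenMass_le_totalMass hnn P

/-- **Total-mass shape + even share ⇒ the even-mass ratio shape ON THE GUARDED SCHEME** (where it
is not explosive): over a compatible window scheme, `NonnegOn`, `EvenShareAvg` and
`MixedOverTotalMassAvg` give `MixedOverMassAvg (ntWindow win) δ` with constant `C/c` (at `D = 1` both
sides vanish; at `D > 1` use `L(1,χ) ≥ 0`, itself forced by `0 ≤ Σ ω A B ≤ C·(Σ ω)·L(1,χ)`, `Σ ω > 0`).
So the landed level-averaged forced split `avgGoodMass_le_of_mixedOverMassAvg` applies, non-vacuously,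
on `ntWindow win`. [cite: IwaniecConversations2006, §7 (7.3)–(7.4)] -/
theorem mixedOverMassAvg_ntWindow {δ : ℝ} (hnn : 𝓕.NonnegOn) (hWC : 𝓕.WindowCompatible win δ)
    (hsh : 𝓕.EvenShareAvg win δ) (htot : 𝓕.MixedOverTotalMassAvg win δ) :
    𝓕.MixedOverMassAvg (𝓕.ntWindow win) δ := by
  obtain ⟨X₁, h₁⟩ := hWC
  obtain ⟨c, hc, X₂, h₂⟩ := hsh
  obtain ⟨C, hC, X₃, h₃⟩ := htot
  refine ⟨C / c, div_pos hC hc, max X₁ (max X₂ X₃), fun X hX D _ χ hprim hquad hD => ?_⟩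
  by_cases hD1 : 1 < D
  · rw [𝓕.ntWindow_of_one_lt χ hD1]
    have hcomp := h₁ X (le_trans (le_max_left _ _) hX) D χ hprim hquad hD
    obtain ⟨hle, hpos⟩ := h₂ X (le_trans (le_trans (le_max_left _ _) (le_max_right _ _)) hX) D χ
      hprim hquad hD1 hD
    have hb := h₃ X (le_trans (le_trans (le_max_right _ _) (le_max_right _ _)) hX) D χ hprim hquad
      hD1 hD
    have hm0 := 𝓕.avgMixedMoment_nonneg hnn (win X D χ) χ hprim hquad hcomp
    have hL : 0 ≤ (χ.LFunction 1).re := by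
      by_contra hneg
      have : C * 𝓕.avgTotalMass (win X D χ) * (χ.LFunction 1).re < 0 :=
        mul_neg_of_pos_of_neg (mul_pos hC hpos) (lt_of_not_ge hneg)
      linarith
    calc 𝓕.avgMixedMoment (win X D χ) χ ≤ C * 𝓕.avgTotalMass (win X D χ) * (χ.LFunction 1).re := hb
      _ ≤ C * (𝓕.avgEvenMass (win X D χ) / c) * (χ.LFunction 1).re := by
          apply mul_le_mul_of_nonneg_right _ hL
          apply mul_le_mul_of_nonneg_left _ hC.le
          rw [le_div_iff₀ hc, mul_comm]
          exact hle
      _ = C / c * 𝓕.avgEvenMass (win X D χ) * (χ.LFunction 1).re := by ring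
  · rw [𝓕.ntWindow_of_not_one_lt χ hD1]
    simp [avgMixedMoment, avgEvenMass]

/-! ## The level-averaged edge implication, re-proved for non-trivial twists -/

/-- **THE EDGE IMPLICATION, LEVEL-AVERAGED, NON-TRIVIAL TWISTS (repaired form).** Over a window scheme
`win` of admissible, COMPATIBLE parameters of size in `[X, KX]` (`WindowBound`, `WindowCompatible`):
`NonnegOn`, the even share of a positive total mass on the window (`EvenShareAvg`), the printed
total-mass moment shape (`MixedOverTotalMassAvg`, constant `C`, `1 < D`), the averaged twisted half at
`p₂` and the averaged edge estimate at `p₁` on the GUARDED scheme `ntWindow win`, `p₁ + p₂ > 1` ⇒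
there is `c₀ > 0` with `L(1,χ) ≥ c₀ (log D)^{−2a}` for all large `D` and all real primitive `χ mod D`.
Same pigeonhole proof as the landed `lOne_lowerBound_of_EStarFamLevelAvg`, whose even-mass hypothesis
`MixedOverMassAvg win δ` is contradictory on `𝓗_k(N)`-like data at `D = 1`; here every `χ`-hypothesis
is consumed only at `D ≥ 2`. [cite: IwaniecConversations2006, §7 (7.7)] -/
theorem lOne_lowerBound_of_EStarFamLevelAvg_total {p₁ p₂ δ K : ℝ} {a : ℕ} (hδ : 0 < δ) (hK : 1 ≤ K)
    (hnn : 𝓕.NonnegOn) (hW : 𝓕.WindowBound win δ K) (hWC : 𝓕.WindowCompatible win δ)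
    (hsh : 𝓕.EvenShareAvg win δ) (hmix : 𝓕.MixedOverTotalMassAvg win δ)
    (htw : 𝓕.TwistedHalfAvg (𝓕.ntWindow win) p₂ a δ)
    (hE : 𝓕.EStarFamLevelAvg (𝓕.ntWindow win) p₁ a δ) (hp : 1 < p₁ + p₂) :
    ∃ c : ℝ, 0 < c ∧ ∃ D₀ : ℕ, ∀ (D : ℕ) [NeZero D] (χ : DirichletCharacter ℂ D), D₀ ≤ D →
      χ.IsPrimitive → MulChar.IsQuadratic χ →
        c * ((Real.log D) ^ (2 * a))⁻¹ ≤ (χ.LFunction 1).re := by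
  classical
  obtain ⟨X₁, h₁⟩ := hE
  obtain ⟨X₂, h₂⟩ := htw
  obtain ⟨c, hc, X₃, h₃⟩ := hsh
  obtain ⟨C, hC, X₄, h₄⟩ := hmix
  obtain ⟨X₅, h₅⟩ := hW
  obtain ⟨X₆, h₆⟩ := hWC
  have hexcess : 0 < p₁ + p₂ - 1 := by linarith
  -- exponent turning `D` into a scale `X = D^κ` with `D ≤ X^δ` and `X ≥ D`
  set κ : ℝ := max 1 δ⁻¹ with hκ
  have hκ1 : 1 ≤ κ := le_max_left _ _
  have hκpos : 0 < κ := by linarith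
  have hκδ : 1 ≤ κ * δ := by
    have : δ⁻¹ * δ = 1 := inv_mul_cancel₀ hδ.ne'
    have h2 : δ⁻¹ * δ ≤ κ * δ := mul_le_mul_of_nonneg_right (le_max_right _ _) hδ.le
    linarith
  -- a common threshold `S ≥ max K 2`
  set S : ℝ := max (max (max X₁ X₂) (max X₃ X₄)) (max (max X₅ X₆) (max K 2)) with hS
  have hS₁ : X₁ ≤ S := le_trans (le_trans (le_max_left _ _) (le_max_left _ _)) (le_max_left _ _)
  have hS₂ : X₂ ≤ S := le_trans (le_trans (le_max_right _ _) (le_max_left _ _)) (le_max_left _ _)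
  have hS₃ : X₃ ≤ S := le_trans (le_trans (le_max_left _ _) (le_max_right _ _)) (le_max_left _ _)
  have hS₄ : X₄ ≤ S := le_trans (le_trans (le_max_right _ _) (le_max_right _ _)) (le_max_left _ _)
  have hS₅ : X₅ ≤ S := le_trans (le_trans (le_max_left _ _) (le_max_left _ _)) (le_max_right _ _)
  have hS₆ : X₆ ≤ S := le_trans (le_trans (le_max_right _ _) (le_max_left _ _)) (le_max_right _ _)
  have hSK : K ≤ S := le_trans (le_trans (le_max_left _ _) (le_max_right _ _)) (le_max_right _ _)
  have hS2 : (2 : ℝ) ≤ S :=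
    le_trans (le_trans (le_max_right _ _) (le_max_right _ _)) (le_max_right _ _)
  refine ⟨(p₁ + p₂ - 1) * c / C * (((2 * κ) ^ (2 * a))⁻¹),
    mul_pos (div_pos (mul_pos hexcess hc) hC) (by positivity), ⌈S⌉₊, ?_⟩
  intro D _ χ hD₀ hprim hquad
  have hDS : S ≤ (D : ℝ) := le_trans (Nat.le_ceil S) (by exact_mod_cast hD₀)
  have hD2 : (2 : ℝ) ≤ (D : ℝ) := le_trans hS2 hDS
  have hD1 : (1 : ℝ) ≤ (D : ℝ) := by linarith
  have hD1' : 1 < D := by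
    have : (1 : ℝ) < (D : ℝ) := by linarith
    exact_mod_cast this
  have hDpos : (0 : ℝ) < (D : ℝ) := by linarith
  have hlogD : 0 < Real.log (D : ℝ) := Real.log_pos (by linarith)
  -- the scale
  set X : ℝ := (D : ℝ) ^ κ with hX
  have hDX : (D : ℝ) ≤ X := by
    have := Real.rpow_le_rpow_of_exponent_le hD1 hκ1
    rwa [Real.rpow_one] at this
  have hXS : S ≤ X := le_trans hDS hDX
  have hX2 : (2 : ℝ) ≤ X := le_trans hS2 hXS
  have hKX : K ≤ X := le_trans hSK hXS
  have hXpos : 0 < X := by linarith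
  have hK0 : 0 < K := by linarith
  have hDXδ : (D : ℝ) ≤ X ^ δ := by
    rw [hX, ← Real.rpow_mul hDpos.le]
    have := Real.rpow_le_rpow_of_exponent_le hD1 hκδ
    rwa [Real.rpow_one] at this
  have hlogX : Real.log X = κ * Real.log (D : ℝ) := by rw [hX, Real.log_rpow hDpos]
  have hlogKX_le : Real.log (K * X) ≤ (2 * κ) * Real.log (D : ℝ) := by
    rw [Real.log_mul hK0.ne' hXpos.ne', hlogX]
    have : Real.log K ≤ Real.log X := Real.log_le_log hK0 hKX
    rw [hlogX] at this
    linarith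
  have hlogKX_pos : 0 < Real.log (K * X) := by
    rw [Real.log_mul hK0.ne' hXpos.ne']
    have h0 : 0 ≤ Real.log K := Real.log_nonneg hK
    have h1 : 0 < Real.log X := Real.log_pos (by linarith)
    linarith
  -- instantiate the averaged shapes at `(X, χ)`; the guarded window IS the window since `1 < D`
  have hb := h₅ X (le_trans hS₅ hXS) D χ hprim hquad hDXδ
  have hcompat : ∀ P ∈ win X D χ, 𝓕.Compatible P χ := h₆ X (le_trans hS₆ hXS) D χ hprim hquad hDXδ
  obtain ⟨hshare, htotPos⟩ := h₃ X (le_trans hS₃ hXS) D χ hprim hquad hD1' hDXδ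
  have hmassPos : 0 < 𝓕.avgEvenMass (win X D χ) :=
    lt_of_lt_of_le (mul_pos hc htotPos) hshare
  have hE' := h₁ X (le_trans hS₁ hXS) D χ hprim hquad hDXδ
  have hT' := h₂ X (le_trans hS₂ hXS) D χ hprim hquad hDXδ
  rw [𝓕.ntWindow_of_one_lt χ hD1'] at hE' hT'
  have hM' := h₄ X (le_trans hS₄ hXS) D χ hprim hquad hD1' hDXδ
  -- the uniform threshold `η = (log KX)⁻ᵃ ≤ (log |P|)⁻ᵃ` on the window
  set η : ℝ := ((Real.log (K * X)) ^ a)⁻¹ with hηdef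
  have hη : 0 ≤ η := by positivity
  have hηfloor : ∀ P ∈ win X D χ, η ≤ 𝓕.floor a P := by
    intro P hP
    obtain ⟨-, hXP, hPK⟩ := hb P hP
    have hPpos : 0 < 𝓕.size P := by linarith
    have hlogP : 0 < Real.log (𝓕.size P) := Real.log_pos (by linarith)
    have hle : Real.log (𝓕.size P) ≤ Real.log (K * X) := Real.log_le_log hPpos hPK
    unfold floor
    exact inv_anti₀ (pow_pos hlogP _) (pow_le_pow_left₀ hlogP.le hle _)
  -- the disjoint union of the even members over the window
  set s : Finset (Σ P : 𝓕.Param, 𝓕.Form P) := (win X D χ).sigma fun P => 𝓕.evenForms P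
    with hsdef
  have hmemP : ∀ x ∈ s, x.1 ∈ win X D χ := fun x hx => (Finset.mem_sigma.1 hx).1
  have hmem : ∀ x ∈ s, x.2 ∈ 𝓕.forms x.1 := fun x hx =>
    𝓕.mem_forms_of_mem_evenForms_avg (Finset.mem_sigma.1 hx).2
  have hsum : ∑ x ∈ s, 𝓕.weight x.1 x.2 = 𝓕.avgEvenMass (win X D χ) := by
    rw [hsdef, Finset.sum_sigma]; rfl
  have hgood : 𝓕.avgGoodMass a (win X D χ) ≤
      ∑ x ∈ s with η ≤ 𝓕.value x.1 x.2, 𝓕.weight x.1 x.2 := by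
    have hrw := 𝓕.sum_sigma_filter_avg (win X D χ) (fun P => 𝓕.evenForms P) 𝓕.weight
      (fun P f => η ≤ 𝓕.value P f)
    beta_reduce at hrw
    rw [hsdef, hrw]
    refine Finset.sum_le_sum fun P hP => ?_
    refine Finset.sum_le_sum_of_subset_of_nonneg ?_ ?_
    · intro f hf
      rw [Finset.mem_filter] at hf ⊢
      exact ⟨hf.1, le_trans (hηfloor P hP) hf.2⟩
    · intro f hf _
      exact (hnn P f (𝓕.mem_forms_of_mem_evenForms_avg (Finset.mem_filter.1 hf).1)).1
  have hgoodT : 𝓕.avgGoodTwistedMass a (win X D χ) χ ≤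
      ∑ x ∈ s with η ≤ 𝓕.twistedValue x.1 x.2 χ, 𝓕.weight x.1 x.2 := by
    have hrw := 𝓕.sum_sigma_filter_avg (win X D χ) (fun P => 𝓕.evenForms P) 𝓕.weight
      (fun P f => η ≤ 𝓕.twistedValue P f χ)
    beta_reduce at hrw
    rw [hsdef, hrw]
    refine Finset.sum_le_sum fun P hP => ?_
    refine Finset.sum_le_sum_of_subset_of_nonneg ?_ ?_
    · intro f hf
      rw [Finset.mem_filter] at hf ⊢
      exact ⟨hf.1, le_trans (hηfloor P hP) hf.2⟩
    · intro f hf _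
      exact (hnn P f (𝓕.mem_forms_of_mem_evenForms_avg (Finset.mem_filter.1 hf).1)).1
  have hmixs : ∑ x ∈ s, 𝓕.weight x.1 x.2 * 𝓕.value x.1 x.2 * 𝓕.twistedValue x.1 x.2 χ ≤
      (C * 𝓕.avgTotalMass (win X D χ)) * (χ.LFunction 1).re := by
    refine le_trans ?_ (by simpa [mul_assoc] using hM')
    rw [hsdef, Finset.sum_sigma]
    exact Finset.sum_le_sum fun P hP =>
      𝓕.evenMixedMoment_le_mixedMoment_of_nonnegOn hnn hprim hquad (hcompat P hP)
  have hMpos : 0 < C * 𝓕.avgTotalMass (win X D χ) := mul_pos hC htotPos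
  have key := CentralValueFamilyPigeonhole.lower_bound_of_mixedMoment_le s
    (fun x => 𝓕.weight x.1 x.2) (fun x => 𝓕.value x.1 x.2) (fun x => 𝓕.twistedValue x.1 x.2 χ)
    p₁ p₂ η (C * 𝓕.avgTotalMass (win X D χ)) ((χ.LFunction 1).re) hη hMpos
    (fun x hx => (hnn x.1 x.2 (hmem x hx)).1)
    (fun x hx => (hnn x.1 x.2 (hmem x hx)).2.1)
    (fun x hx => (hnn x.1 x.2 (hmem x hx)).2.2 χ hprim hquad (hcompat x.1 (hmemP x hx)))
    (by simpa only [hsum] using le_trans hE' hgood)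
    (by simpa only [hsum] using le_trans hT' hgoodT)
    (by simpa only using hmixs)
  -- `key : (p₁ + p₂ - 1) * evenMass * η² / (C * totalMass) ≤ L(1,χ)`; use `evenMass ≥ c·totalMass`
  simp only [hsum] at key
  have key2 : (p₁ + p₂ - 1) * 𝓕.avgEvenMass (win X D χ) * η ^ 2 ≤
      (χ.LFunction 1).re * (C * 𝓕.avgTotalMass (win X D χ)) := (div_le_iff₀ hMpos).1 key
  have hη2 : 0 ≤ η ^ 2 := sq_nonneg η
  have key3 : (p₁ + p₂ - 1) * (c * 𝓕.avgTotalMass (win X D χ)) * η ^ 2 ≤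
      (χ.LFunction 1).re * (C * 𝓕.avgTotalMass (win X D χ)) :=
    le_trans (mul_le_mul_of_nonneg_right (mul_le_mul_of_nonneg_left hshare hexcess.le) hη2) key2
  have key4 : ((p₁ + p₂ - 1) * c * η ^ 2) * 𝓕.avgTotalMass (win X D χ) ≤
      ((χ.LFunction 1).re * C) * 𝓕.avgTotalMass (win X D χ) := by
    calc ((p₁ + p₂ - 1) * c * η ^ 2) * 𝓕.avgTotalMass (win X D χ)
        = (p₁ + p₂ - 1) * (c * 𝓕.avgTotalMass (win X D χ)) * η ^ 2 := by ring
      _ ≤ (χ.LFunction 1).re * (C * 𝓕.avgTotalMass (win X D χ)) := key3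
      _ = ((χ.LFunction 1).re * C) * 𝓕.avgTotalMass (win X D χ) := by ring
  have key5 : (p₁ + p₂ - 1) * c * η ^ 2 ≤ (χ.LFunction 1).re * C :=
    le_of_mul_le_mul_right key4 htotPos
  have hkey' : (p₁ + p₂ - 1) * c / C * η ^ 2 ≤ (χ.LFunction 1).re := by
    rw [div_mul_eq_mul_div, div_le_iff₀ hC]
    exact key5
  -- compare the threshold with `(log D)^{-2a}`
  have hηsq : (((2 * κ) * Real.log (D : ℝ)) ^ (2 * a))⁻¹ ≤ η ^ 2 := by
    have hsq : η ^ 2 = ((Real.log (K * X)) ^ (2 * a))⁻¹ := by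
      rw [hηdef, inv_pow, ← pow_mul, mul_comm a 2]
    rw [hsq]
    exact inv_anti₀ (pow_pos hlogKX_pos _) (pow_le_pow_left₀ hlogKX_pos.le hlogKX_le _)
  have hcoef : 0 ≤ (p₁ + p₂ - 1) * c / C := (div_pos (mul_pos hexcess hc) hC).le
  calc (p₁ + p₂ - 1) * c / C * ((2 * κ) ^ (2 * a))⁻¹ * ((Real.log (D : ℝ)) ^ (2 * a))⁻¹
      = (p₁ + p₂ - 1) * c / C * (((2 * κ) * Real.log (D : ℝ)) ^ (2 * a))⁻¹ := by
        rw [mul_pow, mul_inv]; ring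
    _ ≤ (p₁ + p₂ - 1) * c / C * η ^ 2 := mul_le_mul_of_nonneg_left hηsq hcoef
    _ ≤ (χ.LFunction 1).re := hkey'

end CentralValueFamily

/-! ## `𝓗_k(N)`: the repaired level-averaged decision theorems -/

section HkN

variable {k : ℤ}

/-- Members of the guarded compatible window are compatible with `χ`. [cite: IwaniecConversations2006, §7 (p0096:L27)] -/
theorem compatible_of_mem_ntWindow_compatibleWindow (k : ℤ) (X : ℝ) (D : ℕ) [NeZero D]
    (χ : DirichletCharacter ℂ D) (N : ℕ+)
    (hN : N ∈ (iwaniecSarnakFamily k).ntWindow compatibleWindow X D χ) :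
    (iwaniecSarnakFamily k).Compatible N χ :=
  compatible_of_mem_compatibleWindow k X D χ N ((iwaniecSarnakFamily k).mem_of_mem_ntWindow hN)

/-- **THE EDGE IMPLICATION FOR `𝓗_k(N)`, LEVEL-AVERAGED OVER THE COMPATIBLE WINDOW — REPAIRED.**
Fix `k ≥ 2` and the Lapid–Rallis fact. On the compatible window assume the even share of a positive
total harmonic mass (`EvenShareAvg`) and the PRINTED total-mass ratio shape (7.3)+(7.4)
(`MixedOverTotalMassAvg`, `1 < D`); assume the printed twisted half in its record form
`TwistedProportion k p₂`; and the edge estimate on the GUARDED compatible window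
`EStarFamLevelAvg (ntWindow compatibleWindow) p₁ 2 δ` with `p₁ + p₂ − ε > 1`. Then
`L(1,χ_D) ≥ c (log D)⁻⁴` for all large `D`. Replaces `lOne_lowerBound_of_EStarFamLevelAvg_compatibleWindow`
(vacuous: its hypothesis `MixedOverMassAvg compatibleWindow δ` is false at `D = 1`).
[cite: IwaniecConversations2006, §7 (7.7) and p0097:L15] -/
theorem lOne_lowerBound_of_EStarFamLevelAvg_compatibleWindow_total (hk : 2 ≤ k)
    (hLR : lapidRallis2003_theorem1_gl2Twist) {p₁ p₂ ε δ : ℝ} (hε : 0 < ε) (hδ : 0 < δ)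
    (hsh : (iwaniecSarnakFamily k).EvenShareAvg compatibleWindow δ)
    (hmix : (iwaniecSarnakFamily k).MixedOverTotalMassAvg compatibleWindow δ)
    (htw : TwistedProportion k p₂)
    (hE : (iwaniecSarnakFamily k).EStarFamLevelAvg
      ((iwaniecSarnakFamily k).ntWindow compatibleWindow) p₁ 2 δ)
    (hp : 1 < p₁ + p₂ - ε) :
    ∃ c : ℝ, 0 < c ∧ ∃ D₀ : ℕ, ∀ (D : ℕ) [NeZero D] (χ : DirichletCharacter ℂ D), D₀ ≤ D →
      χ.IsPrimitive → MulChar.IsQuadratic χ →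
        c * ((Real.log D) ^ 4)⁻¹ ≤ (χ.LFunction 1).re := by
  obtain ⟨δ₂, hδ₂, htw'⟩ := TwistedHalf_of_twistedProportion hε htw
  set δ' := min δ δ₂ with hδ'
  have hδ'pos : 0 < δ' := lt_min hδ hδ₂
  have hanti : ∀ {X : ℝ} {D : ℕ}, 1 ≤ X → (D : ℝ) ≤ X ^ δ' → (D : ℝ) ≤ X ^ δ := fun hX hD =>
    le_trans hD (Real.rpow_le_rpow_of_exponent_le hX (min_le_left _ _))
  have hsh' : (iwaniecSarnakFamily k).EvenShareAvg compatibleWindow δ' := by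
    obtain ⟨c, hc, X₀, h⟩ := hsh
    exact ⟨c, hc, max X₀ 1, fun X hX D _ χ hprim hquad h1 hD => h X (le_trans (le_max_left _ _) hX)
      D χ hprim hquad h1 (hanti (le_trans (le_max_right _ _) hX) hD)⟩
  have hmix' : (iwaniecSarnakFamily k).MixedOverTotalMassAvg compatibleWindow δ' := by
    obtain ⟨C, hC, X₀, h⟩ := hmix
    exact ⟨C, hC, max X₀ 1, fun X hX D _ χ hprim hquad h1 hD => h X (le_trans (le_max_left _ _) hX)
      D χ hprim hquad h1 (hanti (le_trans (le_max_right _ _) hX) hD)⟩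
  have hE' : (iwaniecSarnakFamily k).EStarFamLevelAvg
      ((iwaniecSarnakFamily k).ntWindow compatibleWindow) p₁ 2 δ' := by
    obtain ⟨X₀, h⟩ := hE
    exact ⟨max X₀ 1, fun X hX D _ χ hprim hquad hD => h X (le_trans (le_max_left _ _) hX) D χ
      hprim hquad (hanti (le_trans (le_max_right _ _) hX) hD)⟩
  have htwA : (iwaniecSarnakFamily k).TwistedHalfAvg
      ((iwaniecSarnakFamily k).ntWindow compatibleWindow) (p₂ - ε) 2 δ' :=
    (iwaniecSarnakFamily k).TwistedHalfAvg_of_TwistedHalf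
      ((iwaniecSarnakFamily k).windowBound_ntWindow (windowBound_compatibleWindow k δ'))
      (fun X D _ χ N hN => compatible_of_mem_ntWindow_compatibleWindow k X D χ N hN) hδ'pos.le
      (htw'.anti (min_le_right _ _))
  have h := (iwaniecSarnakFamily k).lOne_lowerBound_of_EStarFamLevelAvg_total hδ'pos
    (by norm_num : (1 : ℝ) ≤ 2) (iwaniecSarnakFamily_nonnegOn hk hLR)
    (windowBound_compatibleWindow k δ') (windowCompatible_compatibleWindow k δ') hsh' hmix' htwA
    hE' (by linarith)
  simpa only [show (2 * 2 : ℕ) = 4 from rfl] using h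

/-- **THE COMPATIBILITY EDGE FOR `𝓗_k(N)`, SPLIT — on the guarded schemes.** Plain-window excess
`p + η` and twisted control `≥ −ε` at proportion `p` (both on the guarded schemes, i.e. for `D > 1`
only), `ε ≤ η` ⇒ the guarded compatible edge estimate at `p`. (Same algebra as
`EStarFamLevelAvg_compatibleWindow_of_plain`; the guard removes the unintended `D = 1` conjuncts.)
[cite: IwaniecConversations2006, §7 (7.5) and p0097:L15] -/
theorem EStarFamLevelAvg_ntWindow_compatibleWindow_of_plain (hk : 2 ≤ k)
    (hLR : lapidRallis2003_theorem1_gl2Twist) {p η δ ε : ℝ} {a : ℕ}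
    (hplain : (iwaniecSarnakFamily k).EStarFamLevelAvg
      ((iwaniecSarnakFamily k).ntWindow plainWindow) (p + η) a δ)
    (htw : (iwaniecSarnakFamily k).TwistedExcessLower ((iwaniecSarnakFamily k).ntWindow plainWindow)
      (fun _ _ χ N => twistSign χ N) p a δ ε)
    (hε : ε ≤ η) :
    (iwaniecSarnakFamily k).EStarFamLevelAvg ((iwaniecSarnakFamily k).ntWindow compatibleWindow)
      p a δ :=
  CentralValueFamily.EStarFamLevelAvg_of_signedHalf
    ((iwaniecSarnakFamily k).isSignedHalf_ntWindow (isSignedHalf_compatibleWindow k))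
    (iwaniecSarnakFamily_nonnegOn hk hLR) hplain htw hε

/-- **E*-fam closes (7.7) from the split hypotheses — REPAIRED (non-trivial twists, total mass).**
Plain-window excess `½ + η` and twisted control at `½ + γ` with slack `ε` on the guarded schemes
(`γ > 0`, `γ + ε ≤ η`); the printed twisted half; even share and the printed total-mass ratio shape on
the compatible window ⇒ `L(1,χ_D) ≥ c (log D)⁻⁴` for all large `D`. Replaces
`lOne_lowerBound_of_plain_and_twisted`. [cite: IwaniecConversations2006, §7 (7.7) and p0097:L15] -/
theorem lOne_lowerBound_of_plain_and_twisted_total (hk : 2 ≤ k) (hkev : Even k)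
    (hLR : lapidRallis2003_theorem1_gl2Twist) (hTw : iwaniec2006_twistedHalf) {η γ δ ε : ℝ}
    (hδ : 0 < δ) (hγ : 0 < γ) (hγε : γ + ε ≤ η)
    (hsh : (iwaniecSarnakFamily k).EvenShareAvg compatibleWindow δ)
    (hmix : (iwaniecSarnakFamily k).MixedOverTotalMassAvg compatibleWindow δ)
    (hplain : (iwaniecSarnakFamily k).EStarFamLevelAvg
      ((iwaniecSarnakFamily k).ntWindow plainWindow) (1 / 2 + η) 2 δ)
    (htw : (iwaniecSarnakFamily k).TwistedExcessLower ((iwaniecSarnakFamily k).ntWindow plainWindow)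
      (fun _ _ χ N => twistSign χ N) (1 / 2 + γ) 2 δ ε) :
    ∃ c : ℝ, 0 < c ∧ ∃ D₀ : ℕ, ∀ (D : ℕ) [NeZero D] (χ : DirichletCharacter ℂ D), D₀ ≤ D →
      χ.IsPrimitive → MulChar.IsQuadratic χ →
        c * ((Real.log D) ^ 4)⁻¹ ≤ (χ.LFunction 1).re := by
  have hplain' : (iwaniecSarnakFamily k).EStarFamLevelAvg
      ((iwaniecSarnakFamily k).ntWindow plainWindow) ((1 / 2 + γ) + (η - γ)) 2 δ := by
    have e : (1 / 2 + γ) + (η - γ) = 1 / 2 + η := by ring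
    rw [e]; exact hplain
  have hE := EStarFamLevelAvg_ntWindow_compatibleWindow_of_plain hk hLR hplain' htw (by linarith)
  have hgap : 0 < γ / 2 := by linarith
  exact lOne_lowerBound_of_EStarFamLevelAvg_compatibleWindow_total hk hLR hgap hδ hsh hmix
    (hTw k hk hkev) hE (by linarith)

/-- **«The excess disappears», signed, for `𝓗_k(N)` — REPAIRED.** On the compatible window assume
even share + the printed total-mass ratio shape (constants `c`, `C`) and the averaged twisted half at
`p₂`; on the guarded plain window the (7.5)-excess `η` over `1 − p₂`. Then for all large `X` and real
primitive `χ_D` with `1 < D ≤ X^δ`: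
`Σ_{pW} χ_D(−N)·(goodMass − (1−p₂)·evenMass) ≤ 2(C/c)·L(1,χ_D)(log 2X)^{2a}·Σ_{cW} evenMass − η·Σ_{pW} evenMass`.
(The landed forced split `avgGoodMass_le_of_mixedOverMassAvg` on the guarded compatible scheme, where
its even-mass hypothesis holds by `mixedOverMassAvg_ntWindow`, + `twistedExcess_le_of_split`.)
Replaces `twistedExcess_le_iwaniecSarnakFamily`. [cite: IwaniecConversations2006, §7 p0097:L15] -/
theorem twistedExcess_le_iwaniecSarnakFamily_total (hk : 2 ≤ k)
    (hLR : lapidRallis2003_theorem1_gl2Twist) {p₂ η δ : ℝ} {a : ℕ}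
    (hsh : (iwaniecSarnakFamily k).EvenShareAvg compatibleWindow δ)
    (hmix : (iwaniecSarnakFamily k).MixedOverTotalMassAvg compatibleWindow δ)
    (htw : (iwaniecSarnakFamily k).TwistedHalfAvg compatibleWindow p₂ a δ)
    (hplain : (iwaniecSarnakFamily k).EStarFamLevelAvg
      ((iwaniecSarnakFamily k).ntWindow plainWindow) (1 - p₂ + η) a δ) :
    ∃ C : ℝ, 0 < C ∧ ∃ X₀ : ℝ, ∀ X : ℝ, X₀ ≤ X →
      ∀ (D : ℕ) [NeZero D] (χ : DirichletCharacter ℂ D), χ.IsPrimitive → MulChar.IsQuadratic χ →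
        1 < D → (D : ℝ) ≤ X ^ δ →
          ∑ N ∈ plainWindow X D χ, twistSign χ N *
              ((iwaniecSarnakFamily k).goodMass a N - (1 - p₂) * (iwaniecSarnakFamily k).evenMass N) ≤
            2 * (C * (χ.LFunction 1).re * Real.log (2 * X) ^ (2 * a)) *
                (iwaniecSarnakFamily k).avgEvenMass (compatibleWindow X D χ) -
              η * (iwaniecSarnakFamily k).avgEvenMass (plainWindow X D χ) := by
  set 𝓕 := iwaniecSarnakFamily k with h𝓕
  have hnn : 𝓕.NonnegOn := iwaniecSarnakFamily_nonnegOn hk hLR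
  have hMA : 𝓕.MixedOverMassAvg (𝓕.ntWindow compatibleWindow) δ :=
    𝓕.mixedOverMassAvg_ntWindow hnn (windowCompatible_compatibleWindow k δ) hsh hmix
  obtain ⟨C, hC, X₁, h₁⟩ := 𝓕.avgGoodMass_le_of_mixedOverMassAvg hnn (by norm_num : (1 : ℝ) ≤ 2)
    (𝓕.windowBound_ntWindow (windowBound_compatibleWindow k δ))
    (𝓕.windowCompatible_ntWindow (windowCompatible_compatibleWindow k δ)) hMA
    (𝓕.twistedHalfAvg_ntWindow htw)
  obtain ⟨X₂, h₂⟩ := hplain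
  refine ⟨C, hC, max X₁ X₂, fun X hX D _ χ hprim hquad hD1 hD => ?_⟩
  have hsplit := h₁ X (le_trans (le_max_left _ _) hX) D χ hprim hquad hD
  have hpl := h₂ X (le_trans (le_max_right _ _) hX) D χ hprim hquad hD
  rw [𝓕.ntWindow_of_one_lt χ hD1] at hsplit hpl
  exact CentralValueFamily.twistedExcess_le_of_split (isSignedHalf_compatibleWindow k) X D χ hpl hsplit

end HkN

/-! ## `𝓗_k(N)` under an amplified measure: the repaired (total-mass) decision theorem -/

section Amp

variable {k : ℤ}

/-- **THE EDGE IMPLICATION FOR `𝓗_k(N)` UNDER AN AMPLIFIED MEASURE `ω_f A_f²` — REPAIRED.** Fix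
`k ≥ 2`, a real amplifier `A`, the Lapid–Rallis fact. For the AMPLIFIED family assume: the even share
of a positive total amplified mass (`EvenShare`), the printed-type total-mass ratio shape for
non-trivial twists (`MixedOverTotalMass δ`: `Σ^h ωA² L·L_χ ≤ C·(Σ^h ωA²)·L(1,χ_D)`, `1 < D` —
amplified purity), the amplified twisted half at `p₂`, and the amplified edge estimate at `p₁`,
`p₁ + p₂ > 1`. Then `L(1,χ) ≥ c (log D)⁻⁴` for all large `D`. Via ls-lit-typer-4's
`CentralValueFamily.lOne_lowerBound_of_EStarFam_total` on the reweighted datum; replaces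
`lOne_lowerBound_iwaniecSarnakFamilyAmp_ratio` (vacuous: `MixedOverMass` explodes at `D = 1`).
[cite: IwaniecConversations2006, §7 (7.7)] -/
theorem lOne_lowerBound_iwaniecSarnakFamilyAmp_total (hk : 2 ≤ k)
    (A : (N : ℕ+) → CuspForm (Gamma0 (N : ℕ)) k → ℝ)
    (hLR : lapidRallis2003_theorem1_gl2Twist) {p₁ p₂ δ : ℝ} (hδ : 0 < δ)
    (hsh : (iwaniecSarnakFamilyAmp k A).EvenShare)
    (htot : (iwaniecSarnakFamilyAmp k A).MixedOverTotalMass δ)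
    (htw : (iwaniecSarnakFamilyAmp k A).TwistedHalf p₂ 2 δ)
    (hE : (iwaniecSarnakFamilyAmp k A).EStarFam p₁ 2) (hp : 1 < p₁ + p₂) :
    ∃ c : ℝ, 0 < c ∧ ∃ D₀ : ℕ, ∀ (D : ℕ) [NeZero D] (χ : DirichletCharacter ℂ D), D₀ ≤ D →
      χ.IsPrimitive → MulChar.IsQuadratic χ →
        c * ((Real.log D) ^ 4)⁻¹ ≤ (χ.LFunction 1).re := by
  obtain ⟨K, hK, hsup⟩ := iwaniecSarnakFamilyAmp_compatibleSupply k A hδ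
  have h := CentralValueFamily.lOne_lowerBound_of_EStarFam_total hK
    (iwaniecSarnakFamilyAmp_nonnegOn A hk hLR) hsh htot htw hE hp hsup
  simpa only [show (2 * 2 : ℕ) = 4 from rfl] using h

end Amp

end Literature.NumberTheory.LFunctions.CentralValueFamilyHalfEdge

end
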